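import Summits.HodgeConjecture.CorCM.Milne2020OfRiemann
import Summits.HodgeConjecture.CorCM.Model.CMDominationOfRiemannRealised
import Literature.AlgebraicGeometry.HodgeTheory.WeilClassesCMReduction
import Summits.HodgeConjecture.HodgeConjecture.Theorems.WeilTypeLadder
import HarnessLib

/-!
# COR-CM (cell `pub-hodgecm2`): Milne 2020 Thm. 1 and André 1992 for an ARBITRARY complex abelian
# variety of CM type — modulo Riemann's theorem and the CM-realisation record `h₃` ONLY

HONEST FRAMING. STRUCTURE theorems about Hodge classes of CM abelian varieties; no case of the Hodge
conjecture is proved. `CorCM/Milne2020OfRiemann.lean` derives the Literature record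
`HodgeTheory.Milne2020_hodgeClasses_cmType_mem_span_pullback_weilClassesField_galois` (Milne, arXiv:2010.08857,
§3 Thm. 1 = André 1992) from `hR : DeligneMilne1982_Thm_6_20_full`, `hU : BallQuotientUniformisedDatum` and
`h₃ : CMAbelianVarietyRealised`. The Picard uniformisation datum `hU` entered only through the coded
universe used for the domination step; with the `hU`-free domination
`Domination.cmDominated_of_isOfCMType_of_riemann` (`CorCM/Model/CMDominationOfRiemannRealised.lean`) and
the assembly `Milne2020.milne2020_of_avDominatedBy`, this file records the same theorems on the two
binders `hR` (Riemann's theorem, Deligne–Milne LNM 900 Thm. 6.20 — row B02) and `h₃` (existence of CM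
abelian varieties of every CM type, Shimura 1998 §6.2 Thm. 3 / Milne *CM* Prop. 3.12 — stage 1's record):

* `milne2020_thm1_six_le_of_riemann_realised`, `milne2020_thm1_of_riemann_realised` — Milne 2020 Thm. 1
  (working form with `6 ≤ e`, and the record);
* `andre1992_hodgeClasses_cmAbelianVariety_of_riemann` — the (T-weak) record
  `HodgeTheory.Andre1992_hodgeClasses_cmAbelianVariety_mem_span_pullback_weilClasses` (André 1992 =
  Charles–Schnell Thm. 11.5.21 = Milne endnote M.12, typed without a common field; its hypothesis is
  `Milne1999.IsOfCMType A` by `Iff.rfl`): the common field has degree `e ≥ 6 > 2`, so every summand is in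
  the record's SECOND family, whose clauses are the first six clauses of `IsGaloisCMFieldPoly`;
  consumers holding `(h : Andre1992_…_weilClasses)` (e.g. `Theorems/WeilTypeLadderCMReduction`, the ring-2
  files `Ring2*`) may feed it `andre1992_hodgeClasses_cmAbelianVariety_of_riemann hR h₃`;
* `hc_cm_of_weilClassesField_galois_six_le_of_riemann` (sharpest: Galois CM fields of degree `≥ 6` only),
  `hc_cm_of_weilClassesCMField_of_riemann` (the B2b ladder's rung R3 `WeilTypeLadder.WeilClassesCMField` ALONE
  gives `HC_CM` modulo `hR`, `h₃` — André fact discharged, rung R∞ dropped),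
  `hc_cm_of_weilClassesField_galois_of_riemann_realised`, `…_of_hazama_realised`,
  `mem_algebraicClasses_cmAbelianVariety_of_riemann` — André's reduction «algebraicity of the Weil classes
  ⟹ Hodge for CM abelian varieties» as kernel arrows modulo `hR`, `h₃`.

Theorems only; no named fact (D-0026).

References: [Milne2020HodgeClassesAV] §3 Thm. 1 and proof; [Andre1992HodgeCM] Théorème, p. 2;
[CharlesSchnell2014Notes] Thm. 11.5.21 (pp. 510–511); [Deligne1982HodgeCycles] endnote M.12, §5;
[DeligneMilne1982Tannakian] Thm. 6.20 (Riemann); [Shimura1998] §6.1 Cor. of Thm. 2, §6.2 Thm. 3;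
[Milne2007TateFiniteFieldsAIM] Thm. 8.5; [Hazama2003GHCCM] Thm. 8.3.
-/

noncomputable section

namespace Summit.HodgeConjecture.CorCM.Milne2020

open CategoryTheory NumberField Polynomial
open Literature.AlgebraicGeometry Literature.AlgebraicGeometry.Motives Literature.AlgebraicGeometry.HodgeTheory
open Literature.AlgebraicGeometry.Milne1999 Literature.NumberTheory.Automorphic
open Literature.NumberTheory.Automorphic.PicardCM (CMAbelianVarietyRealised)
open Summit.HodgeConjecture.CorCM.Domination
open Summit.HodgeConjecture.CorCM.AndreProductForm

/-- **Milne 2020, Theorem 1, modulo Riemann's theorem and `h₃` only — working form with the degree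
bound**: for every complex abelian variety `A` of CM type, ONE Galois CM field polynomial `P` of degree
`e ≥ 6` such that every rational `(p,p)` class on `A`, for every `p`, is a `ℂ`-combination of pull-backs
`g^*(w)` of rational `(p,p)` classes `w ∈ weilClassesField B ψ P (2p)` with `P(ψ) = 0`,
`e · 2p = 2 dim B`. Domination: `Domination.cmDominated_of_isOfCMType_of_riemann` (no `hU`); assembly:
`milne2020_of_avDominatedBy`. [cite: Milne2020HodgeClassesAV, §3 Thm. 1 and its proof]
[cite: Andre1992HodgeCM, Théorème] [cite: DeligneMilne1982Tannakian, §6 Thm. 6.20 (Riemann)]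
[cite: Shimura1998, §6.1 Cor. of Thm. 2, §6.2 Thm. 3] -/
theorem milne2020_thm1_six_le_of_riemann_realised (hR : DeligneMilne1982_Thm_6_20_full)
    (h₃ : CMAbelianVarietyRealised) (A : AbelianVariety ℂ) (hCM : IsOfCMType A) :
    ∃ (P : Polynomial ℤ) (e : ℕ), IsGaloisCMFieldPoly P e ∧ 6 ≤ e ∧
      ∀ (p : ℕ) (c : complexBetti A.X (2 * p)), IsRationalClass c →
        IsOfHodgeType A.dim A.X (2 * p) p p c → c ∈ Submodule.span ℂ (weilClassPullbacksField A P e p) := by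
  obtain ⟨F, _instF, _instNF, _instCM, hGal, h6, n, Θ, hdom⟩ := cmDominated_of_isOfCMType_of_riemann hR h₃ A hCM
  haveI : IsGalois ℚ F := hGal
  obtain ⟨a₀, hsep⟩ := exists_integer_separating F
  exact ⟨minpoly ℤ a₀, Module.finrank ℚ F, isGaloisCMFieldPoly_minpoly F a₀ hsep, h6,
    fun p c hcQ hcH => milne2020_of_avDominatedBy h₃ Θ hdom a₀ p c hcQ hcH⟩

/-- **Milne 2020, Theorem 1 (= André 1992) for EVERY complex abelian variety of CM type — modulo Riemann's
theorem `hR` and the CM-realisation record `h₃` only**: the Literature record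
`HodgeTheory.Milne2020_hodgeClasses_cmType_mem_span_pullback_weilClassesField_galois` HOLDS under these two
binders. [cite: Milne2020HodgeClassesAV, §3 Thm. 1 and its proof] [cite: Andre1992HodgeCM, Théorème]
[cite: DeligneMilne1982Tannakian, §6 Thm. 6.20 (Riemann)] -/
theorem milne2020_thm1_of_riemann_realised (hR : DeligneMilne1982_Thm_6_20_full)
    (h₃ : CMAbelianVarietyRealised) :
    Milne2020_hodgeClasses_cmType_mem_span_pullback_weilClassesField_galois := fun A _ hCM =>
  let ⟨P, e, hP, _, h⟩ := milne2020_thm1_six_le_of_riemann_realised hR h₃ A hCM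
  ⟨P, e, hP, h⟩

/-- **André 1992 (= Charles–Schnell Thm. 11.5.21, Milne endnote M.12) for EVERY complex abelian variety of
CM type — modulo Riemann's theorem `hR` and the CM-realisation record `h₃` only.** The record
`HodgeTheory.Andre1992_hodgeClasses_cmAbelianVariety_mem_span_pullback_weilClasses` HOLDS under these two
binders: by `milne2020_thm1_six_le_of_riemann_realised` every rational `(k,k)` class on `A` is a
`ℂ`-combination of pull-backs of rational `(k,k)` classes of `weilClassesField B ψ P (2k)` for ONE Galois CM
field polynomial `P` of degree `e ≥ 6 > 2` — the record's second family of generators.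
[cite: Andre1992HodgeCM, Théorème (pp. 1–7)] [cite: CharlesSchnell2014Notes, Thm. 11.5.21 (p. 510) and proof (pp. 510–511)]
[cite: Deligne1982HodgeCycles, endnote M.12 (p. 64)] [cite: Milne2020HodgeClassesAV, §3 Thm. 1]
[cite: DeligneMilne1982Tannakian, §6 Thm. 6.20 (Riemann)] -/
theorem andre1992_hodgeClasses_cmAbelianVariety_of_riemann (hR : DeligneMilne1982_Thm_6_20_full)
    (h₃ : CMAbelianVarietyRealised) :
    Andre1992_hodgeClasses_cmAbelianVariety_mem_span_pullback_weilClasses := by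
  intro A _hX hCM k c hcQ hcH
  obtain ⟨P, e, hP, h6, h⟩ := milne2020_thm1_six_le_of_riemann_realised hR h₃ A hCM
  refine Submodule.span_mono ?_ (h k c hcQ hcH)
  rintro _ ⟨B, g, ψ, w, hψ, hdim, hweil, hwQ, hwH, rfl⟩
  obtain ⟨hPm, hPe, -, hPirr, hreal, hQ, -⟩ := hP
  exact Or.inr ⟨B, g, ψ, P, e, w, hPm, hPe, by omega, hPirr, hψ, hdim, hreal, hQ, hweil, hwQ, hwH, rfl⟩

/-- **Milne's hypothesis (H) for every complex abelian variety from the Weil classes of Galois CM fields,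
modulo Riemann's theorem and `h₃`**: the tree's `cmHodgeHypothesisAt_of_milne2020` fed with
`milne2020_thm1_of_riemann_realised`. [cite: Milne2020HodgeClassesAV, §3 Thm. 1]
[cite: Andre1992HodgeCM, p. 2 and Théorème] [cite: DeligneMilne1982Tannakian, §6 Thm. 6.20 (Riemann)] -/
theorem cmHodgeHypothesisAt_of_weilClassesField_galois_of_riemann_realised
    (hR : DeligneMilne1982_Thm_6_20_full) (h₃ : CMAbelianVarietyRealised)
    (hW : ∀ (P : Polynomial ℤ) (e : ℕ), IsGaloisCMFieldPoly P e →
      ∀ (B : AbelianVariety ℂ) (ψ : B ⟶ B) (p : ℕ),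
        Polynomial.eval₂ (Int.castRingHom (CategoryTheory.End B)) (ψ : CategoryTheory.End B) P = 0 →
        e * (2 * p) = 2 * B.dim →
          ∀ w ∈ weilClassesField B ψ P (2 * p), IsRationalClass w →
            IsOfHodgeType B.dim B.X (2 * p) p p w → w ∈ algebraicClasses B.X p)
    (A : AbelianVariety ℂ) : Milne1999.CMHodgeHypothesisAt A :=
  cmHodgeHypothesisAt_of_milne2020 (milne2020_thm1_of_riemann_realised hR h₃) hW A

/-- **`HC_CM` from the algebraicity of the Weil classes of Galois CM fields (every `F`-rank), modulo
Riemann's theorem and `h₃`** — André's 1992 reduction as a kernel arrow.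
[cite: Milne2020HodgeClassesAV, §3 Thm. 1] [cite: Andre1992HodgeCM, p. 2] [cite: Milne1999, §7 p. 72 (hypothesis (H))] -/
theorem hc_cm_of_weilClassesField_galois_of_riemann_realised (hR : DeligneMilne1982_Thm_6_20_full)
    (h₃ : CMAbelianVarietyRealised)
    (hW : ∀ (P : Polynomial ℤ) (e : ℕ), IsGaloisCMFieldPoly P e →
      ∀ (B : AbelianVariety ℂ) (ψ : B ⟶ B) (p : ℕ),
        Polynomial.eval₂ (Int.castRingHom (CategoryTheory.End B)) (ψ : CategoryTheory.End B) P = 0 →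
        e * (2 * p) = 2 * B.dim →
          ∀ w ∈ weilClassesField B ψ P (2 * p), IsRationalClass w →
            IsOfHodgeType B.dim B.X (2 * p) p p w → w ∈ algebraicClasses B.X p) :
    HC_CM :=
  hc_cm_iff_forall_cmHodgeHypothesisAt.mpr
    (cmHodgeHypothesisAt_of_weilClassesField_galois_of_riemann_realised hR h₃ hW)

/-- **The sharpest form: `HC_CM` from the Weil classes of Galois CM fields of degree `≥ 6` only, modulo
Riemann's theorem and `h₃`.** Since the common field of the domination has degree `e ≥ 6`, it suffices
that the rational `(p,p)` classes of `weilClassesField B ψ P (2p)` be algebraic for the Galois CM field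
polynomials `P` of degree `e ≥ 6` (every `B` with `P(ψ) = 0`, `e · 2p = 2 dim B`, every `p`); small CM
fields never occur as targets (their types are induced to the common field).
[cite: Milne2020HodgeClassesAV, §3 Thm. 1 and proof] [cite: Andre1992HodgeCM, p. 2]
[cite: DeligneMilne1982Tannakian, §6 Thm. 6.20 (Riemann)] -/
theorem hc_cm_of_weilClassesField_galois_six_le_of_riemann (hR : DeligneMilne1982_Thm_6_20_full)
    (h₃ : CMAbelianVarietyRealised)
    (hW : ∀ (P : Polynomial ℤ) (e : ℕ), IsGaloisCMFieldPoly P e → 6 ≤ e →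
      ∀ (B : AbelianVariety ℂ) (ψ : B ⟶ B) (p : ℕ),
        Polynomial.eval₂ (Int.castRingHom (CategoryTheory.End B)) (ψ : CategoryTheory.End B) P = 0 →
        e * (2 * p) = 2 * B.dim →
          ∀ w ∈ weilClassesField B ψ P (2 * p), IsRationalClass w →
            IsOfHodgeType B.dim B.X (2 * p) p p w → w ∈ algebraicClasses B.X p) :
    HC_CM := by
  refine hc_cm_iff_forall_cmHodgeHypothesisAt.mpr fun A hX hCM => ⟨nonempty_hodgeModel_holds hX, ?_⟩
  obtain ⟨P, e, hP, h6, h⟩ := milne2020_thm1_six_le_of_riemann_realised hR h₃ A hCM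
  exact fun p c hcQ hcH =>
    (Submodule.span_le.mpr (weilClassPullbacksField_subset_algebraicClasses (hW P e hP h6) hX p))
      (h p c hcQ hcH)

/-- **R5 ⇐ R3 on the B2b `hodge-weil` ladder, modulo Riemann's theorem and `h₃` — with the André fact
DISCHARGED and the rung R∞ DROPPED.** The ladder's edge `[André 1992] → R∞ → R3 → CMAbelianHodge`
(`WeilTypeLadder.cmAbelianHodge_of_andre_of_rungs`, binders: the (T-weak) André record, R∞ =
`WeilClassesImaginaryQuadratic`, R3 = `WeilClassesCMField`) becomes: R3 alone (Weil classes of CM fields of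
degree `e > 2`, here used only at the Galois CM field polynomials of degree `≥ 6` produced by the
domination) implies `HC_CM` (= `RankFourFaces.CMAbelianHodge`), modulo `hR`, `h₃`. Imaginary quadratic
fields never occur as targets: their CM types are induced to the common Galois field of degree `≥ 6`.
[cite: Andre1992HodgeCM, Théorème] [cite: Markman2025SurveySecant, Thm. 1.4 and §12]
[cite: DeligneMilne1982Tannakian, §6 Thm. 6.20 (Riemann)] -/
theorem hc_cm_of_weilClassesCMField_of_riemann (hR : DeligneMilne1982_Thm_6_20_full)
    (h₃ : CMAbelianVarietyRealised) (hR3 : HodgeConjecture.WeilTypeLadder.WeilClassesCMField) : HC_CM :=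
  hc_cm_of_weilClassesField_galois_six_le_of_riemann hR h₃
    fun P e hP h6 B ψ p hψ hdim w hw hwQ hwH =>
      hR3 B ψ P e p hP.1 hP.2.1 (by omega) hP.2.2.2.1 hψ hdim hP.2.2.2.2.1 hP.2.2.2.2.2.1 w hw hwQ hwH

/-- **`HC_CM` from the `F`-rank-FOUR Weil classes of Galois CM fields, modulo Riemann's theorem, `h₃` and
Hazama's codimension-two reduction** (`Hazama2003_generalHodge_cmType_of_hodge_codimTwo` = Milne, AIM talk,
Thm. 8.5). [cite: Milne2020HodgeClassesAV, §3 Thm. 1] [cite: Milne2007TateFiniteFieldsAIM, Thm. 8.5]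
[cite: Hazama2003GHCCM, Thm. 8.3 p. 655] -/
theorem hc_cm_of_rankFourWeilClassesField_galois_of_riemann_of_hazama_realised
    (hR : DeligneMilne1982_Thm_6_20_full) (h₃ : CMAbelianVarietyRealised)
    (h83 : Hazama2003_generalHodge_cmType_of_hodge_codimTwo)
    (h₄ : ∀ (P : Polynomial ℤ) (e : ℕ), IsGaloisCMFieldPoly P e →
      ∀ (B : AbelianVariety ℂ) (ψ : B ⟶ B),
        Polynomial.eval₂ (Int.castRingHom (CategoryTheory.End B)) (ψ : CategoryTheory.End B) P = 0 →
        e * (2 * 2) = 2 * B.dim →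
          ∀ w ∈ weilClassesField B ψ P (2 * 2), IsRationalClass w →
            IsOfHodgeType B.dim B.X (2 * 2) 2 2 w → w ∈ algebraicClasses B.X 2) :
    HC_CM :=
  hc_cm_iff_forall_cmHodgeHypothesisAt.mpr
    (cmHodgeHypothesisAt_of_milne2020_of_rankFourWeilGalois (milne2020_thm1_of_riemann_realised hR h₃) h83 h₄)

/-- **André's reduction of the Hodge conjecture for CM abelian varieties to Weil classes, modulo Riemann's
theorem and `h₃`**, in the (T-weak) record's two-family form: the tree's
`mem_algebraicClasses_cmAbelianVariety_of_andre1992` fed with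
`andre1992_hodgeClasses_cmAbelianVariety_of_riemann`. [cite: Andre1992HodgeCM, Théorème and p. 2]
[cite: CharlesSchnell2014Notes, Thm. 11.5.21 (p. 510)] [cite: DeligneMilne1982Tannakian, §6 Thm. 6.20 (Riemann)] -/
theorem mem_algebraicClasses_cmAbelianVariety_of_riemann (hR : DeligneMilne1982_Thm_6_20_full)
    (h₃ : CMAbelianVarietyRealised)
    (h₂ : ∀ (k d : ℕ), 0 < d → ∀ (B : AbelianVariety ℂ) (ψ : B ⟶ B), B.dim = 2 * k →
      ψ ≫ ψ = -(d • 𝟙 B) → ∀ w : complexBetti B.X (2 * k), IsRationalClass w →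
        IsOfHodgeType (2 * k) B.X (2 * k) k k w → w ∈ weilClassesOf B ψ k d → w ∈ algebraicClasses B.X k)
    (h₃' : ∀ (B : AbelianVariety ℂ) (ψ : B ⟶ B) (P : Polynomial ℤ) (e k : ℕ),
      P.Monic → P.natDegree = e → 2 < e → Irreducible (P.map (Int.castRingHom ℚ)) →
      Polynomial.eval₂ (Int.castRingHom (CategoryTheory.End B)) (ψ : CategoryTheory.End B) P = 0 →
      e * (2 * k) = 2 * B.dim →
      (∀ ρ : ℂ, Polynomial.eval₂ (Int.castRingHom ℂ) ρ P = 0 → starRingEnd ℂ ρ ≠ ρ) →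
      (∃ Q : Polynomial ℚ, ∀ ρ : ℂ, Polynomial.eval₂ (Int.castRingHom ℂ) ρ P = 0 →
          Polynomial.eval₂ (algebraMap ℚ ℂ) ρ Q = starRingEnd ℂ ρ) →
        ∀ w ∈ weilClassesField B ψ P (2 * k), IsRationalClass w →
          IsOfHodgeType B.dim B.X (2 * k) k k w → w ∈ algebraicClasses B.X k)
    (A : AbelianVariety ℂ) (hX : IsSmoothProjective A.dim A.X) (hCM : IsOfCMType A)
    (k : ℕ) (c : complexBetti A.X (2 * k)) (hcQ : IsRationalClass c)
    (hcH : IsOfHodgeType A.dim A.X (2 * k) k k c) : c ∈ algebraicClasses A.X k :=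
  mem_algebraicClasses_cmAbelianVariety_of_andre1992
    (andre1992_hodgeClasses_cmAbelianVariety_of_riemann hR h₃) h₂ h₃' A hX hCM k c hcQ hcH

end Summit.HodgeConjecture.CorCM.Milne2020

end
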